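import Summits.BirchSwinnertonDyer.Rank1Residual.Additive.KatoDescentPerrinRiouRatioUnitOfFacts
import Summits.BirchSwinnertonDyer.Rank1Residual.Additive.KatoDescentKummerLogLinear
import Literature.NumberTheory.EllipticCurves.Kato2004.LocPKernelRankOnePlumbing
import Literature.NumberTheory.EllipticCurves.Kato2004.IwasawaH2DataOfInjectivityProofs
import Mathlib.RingTheory.PowerSeries.Order
import Mathlib.LinearAlgebra.Dimension.Basic
import HarnessLib

set_option autoImplicit false

/-!
# The display KATO-RIGID of the PR-INV lane ⟸ Kato's Thm. 12.4 (2) (`Kato2004.thm12_4`) + the AUGMENTATION display AUG: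
# collinearity in the rank-one Iwasawa cohomology, its bottom layer, and the Kummer logarithm
# (seat `bsd-cm-prr-ty1` g14, cell `bsd-cm`; theorems only: no definition, no named fact, no instance, no `sorry`)

Part 41 of the seat's kernel cut of stub 3 of the Kato–Perrin-Riou skeletons v4 (cruxes stmt-BirchSwinnertonDyer-19945 /
-19223).  After Parts 38–40 (E25–E27) the display PR-INV of stub 3 reads PR-INV ⟸ {`IsNewformOf.level_eq_conductorNorm`,
KATO-RIGID} (`PerrinRiouUnit.prInv_of_lev_of_katoRigid`), KATO-RIGID being Kato's §13.9 rigidity (p. 230): «Since 𝐇¹(V_{F_λ}(f)) is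
a free Λ[1/p]-module of rank 1 (Thm 12.4 (2)), this shows that z_γ^{(p)} is independent of the choices … By Thm 12.4 (2), this is
obtained by computing the images … under the map (13.7.1) by using Thm 6.6 and Thm 9.7» — in the tree's currency: two
admissible families lifted into ONE pin `I : IwasawaH1Data W p K γ` whose value maps are unit-proportional have proportional
bottom Kummer logarithms.  THIS FILE splits KATO-RIGID along Kato's two sentences and PROVES the first:
* RANK ONE (`Kato2004.thm12_4`, Thm. 12.4 (2): `I.H` torsion free of `Λ`-rank `1`) ⟹ the two lifts are COLLINEAR over
  `Λ = ℤ_p⟦X⟧` with a PRIMITIVE relation `F • y₁ = G • y₂`, `F(0) ≠ 0 ∨ G(0) ≠ 0` (§2: a pair in a rank-one module is linearly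
  dependent, `LinearIndependent.cardinal_le_rank`; common powers of `X` cancel in a torsion-free module, `PowerSeries.divXPowOrder`);
* BOTTOM LAYER (§1): `proj₀ (F • y) = F(0) • proj₀ y` (the tree's `IwasawaH1Data.proj_zero_smul`,
  `Kato2004/IwasawaH2DataOfInjectivityProofs.lean`: `X = conj_γ − 1` dies in the bottom layer, constants act as scalars), so `F(0) • z₁⁰ = G(0) • z₂⁰` at the top
  (`layerZeroToTop_smul`) and the Kummer logarithms satisfy `F(0)·t₁ = G(0)·t₂` (`hasLocPKummerLog_smul_eq`);
* the second sentence is DISPLAYED as AUG («the images under (13.7.1)»): for every primitive collinear pair,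
  `e · (q₁R₁E₁) · F(0) = (q₂R₂E₂) · G(0)` — the augmentations of the collinearity coefficients are in the ratio of the
  trivial-character constants (cusp factors `ratCuspFactor`, Euler factors `eulerFactorAtOne`) of the two families;
* field algebra (§2 `mul_eq_mul_of_collinear`): `F(0)t₁ = G(0)t₂`, `e c₁ F(0) = c₂ G(0)`, `F(0) ≠ 0 ∨ G(0) ≠ 0` ⟹ `e c₁ t₂ = c₂ t₁`
  (if `G(0) = 0` both sides vanish: `t₁ = 0` and `e c₁ = 0`).
So **KATO-RIGID ⟸ {thm12_4, AUG}** (`katoRigid_of_thm12_4_of_aug`), and with Part 40 (E27 `prInv_of_lev_of_katoRigid`, UNIT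
proved) the lane reads **PR-INV ⟸ {lev, thm12_4, AUG}** — `prInv_of_lev_of_katoRigid hlev (katoRigid_of_thm12_4_of_aug h12 hAUG)`,
not restated in this file (which imports E25 only).  AUG is what remains of Kato's §13.9 in this lane: the character-by-character comparison of
the (13.7.1)-values of the two families (Thm 6.6 / Thm 9.7 = the tree's `ZetaBody` clause (C5)), Rohrlich's non-vanishing, and
the passage from almost all characters to the augmentation (Weierstrass preparation) — DISPLAYED here, not proved.
HONEST LABEL: theorems only; `Kato2004.thm12_4` is a NAMED FACT of the tree (no `_holds`), entering as a hypothesis; AUG is a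
display; no stub is closed; nothing is asserted on 19945 / 19223; no summit statement is proved; Perrin-Riou's conjecture and
Kato's Main Conjecture are untouched; BSD is not proved for any curve.
References: [Kato2004Asterisque] Thm. 12.4 (2) (p. 221), §13.9–Lemma 13.10 (pp. 229–230) [corpus: paper:doi-10-24033-ast-639 p115
L8–L9, L84–L85]; [BlochKato1990] Prop. 3.8, Ex. 3.11; [Washington1997] §7.1 (Λ = ℤ_p⟦T⟧, `X ↦ γ − 1`), §13.2.
-/

noncomputable section

open scoped Classical NumberField BigOperators TensorProduct

open WeierstrassCurve Field IsDedekindDomain NumberField Rat.HeightOneSpectrum CongruenceSubgroup ValuativeRel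
  Literature.NumberTheory.EllipticCurves Literature.NumberTheory.EllipticCurves.ModularForms
  Literature.NumberTheory.EllipticCurves.Rank1Residual Literature.NumberTheory.EllipticCurves.Rank1Residual.Typed
  Literature.NumberTheory.EllipticCurves.Kato2004 Literature.NumberTheory.EllipticCurves.IwasawaAlgebra
  Literature.NumberTheory.EllipticCurves.Kato2004.EulerSystemValues
  Literature.NumberTheory.GaloisRepresentations Literature.NumberTheory.GaloisRepresentations.PeriodRingData
  Literature.NumberTheory.GaloisRepresentations.IsNonarchimedeanLocalField Literature.NumberTheory.PAdicHodge
  Literature.NumberTheory.AdelicBaseChange Literature.NumberTheory.Automorphic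
open Summit.BirchSwinnertonDyer.BirchSwinnertonDyer.Theorems.CongruentShaFreeCutKatoKummerLogTorsion
open Summit.BirchSwinnertonDyer.Rank1Residual Summit.BirchSwinnertonDyer.Rank1Residual.Additive

namespace Summit.BirchSwinnertonDyer.Rank1Residual.Additive.PerrinRiouUnit

/-! ## §1 The bottom Kummer logarithms of collinear elements of `𝐇¹` -/

section Bottom

variable (W : WeierstrassCurve ℚ) [W.IsElliptic] (p : ℕ) [Fact p.Prime] [ContinuousSMul ℤ_[p] (W.tateModule p)]
  {K : ZpExtension ℚ p} {γ : absoluteGaloisGroup ℚ} (I : Kato2004.IwasawaH1Data W p K γ)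

/-- **Bottom Kummer logarithms of collinear elements**: `F • y₁ = G • y₂` in `𝐇¹` and Kummer logarithms `tᵢ` of the bottom
classes `layerZeroToTop (proj₀ yᵢ)` give `F(0)·t₁ = G(0)·t₂` (the tree's `IwasawaH1Data.proj_zero_smul` — `Λ` acts on the bottom
layer through the augmentation, `Kato2004/IwasawaH2DataOfInjectivityProofs.lean` —, `layerZeroToTop_smul`, and the
`ℤ_p`-linearity and uniqueness of the Kummer logarithm, `ContraCount.hasLocPKummerLog_smul_eq`). [cite: Kato2004Asterisque, §13.9 (p. 230)]
[cite: BlochKato1990, Example 3.11] -/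
theorem constantCoeff_mul_kummerLog_eq [W.IsGloballyMinimal] {F G : IwasawaAlgebra p} {y₁ y₂ : I.H}
    (h : F • y₁ = G • y₂) {t₁ t₂ : ℚ_[p]}
    (ht₁ : HasLocPKummerLog W p (layerZeroToTop W p K (I.proj 0 y₁)) t₁)
    (ht₂ : HasLocPKummerLog W p (layerZeroToTop W p K (I.proj 0 y₂)) t₂) :
    ((PowerSeries.constantCoeff F : ℤ_[p]) : ℚ_[p]) * t₁ = ((PowerSeries.constantCoeff G : ℤ_[p]) : ℚ_[p]) * t₂ := by
  refine ContraCount.hasLocPKummerLog_smul_eq W p ?_ ht₁ ht₂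
  rw [← layerZeroToTop_smul, ← layerZeroToTop_smul, ← I.proj_zero_smul, ← I.proj_zero_smul, h]

end Bottom

/-! ## §2 Primitive collinearity in a torsion-free `Λ`-module of rank one; the field algebra -/

section Collinear

variable {p : ℕ} [Fact p.Prime] {M : Type} [AddCommGroup M] [Module (IwasawaAlgebra p) M]
  [Module.IsTorsionFree (IwasawaAlgebra p) M]

/-- Cancelling a common power of `X`: from `F • y₁ = G • y₂` with `F ≠ 0` and `ord F ≤ ord G`, the pair
`(F/X^{ord F}, G/X^{ord F})` is a collinearity relation with `F/X^{ord F}(0) ≠ 0` (`PowerSeries.divXPowOrder`; `X^n` is regular on a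
torsion-free module). [cite: Washington1997, §7.1] -/
theorem exists_primitive_of_smul_eq_smul_of_order_le {F G : IwasawaAlgebra p} {y₁ y₂ : M} (h : F • y₁ = G • y₂)
    (hF : F ≠ 0) (hle : F.order ≤ G.order) :
    ∃ F' G' : IwasawaAlgebra p, F' • y₁ = G' • y₂ ∧
      (PowerSeries.constantCoeff F' ≠ 0 ∨ PowerSeries.constantCoeff G' ≠ 0) := by
  have hFk : (PowerSeries.X : IwasawaAlgebra p) ^ F.order.toNat * PowerSeries.divXPowOrder F = F :=
    PowerSeries.X_pow_order_mul_divXPowOrder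
  have hGk : (PowerSeries.X : IwasawaAlgebra p) ^ F.order.toNat ∣ G := by
    rcases eq_or_ne G 0 with rfl | hG
    · exact dvd_zero _
    · exact (pow_dvd_pow PowerSeries.X (ENat.toNat_le_toNat hle (PowerSeries.order_eq_top.not.mpr hG))).trans
        PowerSeries.X_pow_order_dvd
  obtain ⟨G', hG'⟩ := hGk
  refine ⟨PowerSeries.divXPowOrder F, G', ?_, Or.inl (PowerSeries.constantCoeff_divXPowOrder_eq_zero_iff.not.mpr hF)⟩
  have hX : ((PowerSeries.X : IwasawaAlgebra p) ^ F.order.toNat) ≠ 0 := pow_ne_zero _ PowerSeries.X_ne_zero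
  rw [← smul_right_inj hX, ← mul_smul, ← mul_smul, hFk, ← hG', h]

/-- **Primitive collinearity from a non-trivial relation**: `F • y₁ = G • y₂` with `(F, G) ≠ (0, 0)` in a torsion-free
`Λ`-module can be renormalised to `F(0) ≠ 0 ∨ G(0) ≠ 0`. [cite: Washington1997, §7.1] -/
theorem exists_primitive_of_smul_eq_smul {F G : IwasawaAlgebra p} {y₁ y₂ : M} (h : F • y₁ = G • y₂) (hne : F ≠ 0 ∨ G ≠ 0) :
    ∃ F' G' : IwasawaAlgebra p, F' • y₁ = G' • y₂ ∧
      (PowerSeries.constantCoeff F' ≠ 0 ∨ PowerSeries.constantCoeff G' ≠ 0) := by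
  rcases le_total F.order G.order with hle | hle
  · have hF : F ≠ 0 := by
      rcases hne with hF | hG
      · exact hF
      · rintro rfl
        rw [PowerSeries.order_zero, top_le_iff, PowerSeries.order_eq_top] at hle
        exact hG hle
    exact exists_primitive_of_smul_eq_smul_of_order_le h hF hle
  · have hG : G ≠ 0 := by
      rcases hne with hF | hG
      · rintro rfl
        rw [PowerSeries.order_zero, top_le_iff, PowerSeries.order_eq_top] at hle
        exact hF hle
      · exact hG
    obtain ⟨G', F', h', hcc⟩ := exists_primitive_of_smul_eq_smul_of_order_le h.symm hG hle
    exact ⟨F', G', h'.symm, hcc.symm⟩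

/-- **Two elements of a torsion-free `Λ`-module of rank one are primitively collinear** (a pair is linearly dependent when the
rank is `1`, `LinearIndependent.cardinal_le_rank`; then §2 `exists_primitive_of_smul_eq_smul`).
[cite: Kato2004Asterisque, Thm. 12.4 (2) (p. 221) and §13.9 (p. 230)] -/
theorem exists_primitive_collinear (hrank : Module.rank (IwasawaAlgebra p) M = 1) (y₁ y₂ : M) :
    ∃ F G : IwasawaAlgebra p, F • y₁ = G • y₂ ∧
      (PowerSeries.constantCoeff F ≠ 0 ∨ PowerSeries.constantCoeff G ≠ 0) := by
  have hdep : ¬ LinearIndependent (IwasawaAlgebra p) ![y₁, y₂] := by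
    intro hli
    have h2 := hli.cardinal_le_rank
    rw [hrank, Cardinal.mk_fin] at h2
    norm_num [Nat.succ_eq_add_one] at h2
  rw [LinearIndependent.pair_iff] at hdep
  push Not at hdep
  obtain ⟨s, t, hst, hne⟩ := hdep
  have hrel : s • y₁ = (-t) • y₂ := by
    rw [neg_smul, eq_neg_iff_add_eq_zero, hst]
  refine exists_primitive_of_smul_eq_smul hrel ?_
  by_cases hs : s = 0
  · exact Or.inr (neg_ne_zero.mpr (hne hs))
  · exact Or.inl hs

/-- The field algebra of the assembly: `F₀t₁ = G₀t₂`, `e c₁ F₀ = c₂ G₀`, `F₀ ≠ 0 ∨ G₀ ≠ 0` ⟹ `e c₁ t₂ = c₂ t₁`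
(if `G₀ = 0`: `t₁ = 0` and `e c₁ = 0`). [folklore] -/
theorem mul_eq_mul_of_collinear {L : Type*} [Field L] {F₀ G₀ t₁ t₂ e c₁ c₂ : L} (hprim : F₀ ≠ 0 ∨ G₀ ≠ 0)
    (hstar : F₀ * t₁ = G₀ * t₂) (hdag : e * c₁ * F₀ = c₂ * G₀) : e * c₁ * t₂ = c₂ * t₁ := by
  by_cases hG : G₀ = 0
  · have hF : F₀ ≠ 0 := hprim.resolve_right (not_not.mpr hG)
    rw [hG, zero_mul] at hstar
    rw [hG, mul_zero] at hdag
    rw [(mul_eq_zero.mp hstar).resolve_left hF, (mul_eq_zero.mp hdag).resolve_right hF, zero_mul, mul_zero]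
  · apply mul_right_cancel₀ hG
    calc e * c₁ * t₂ * G₀ = e * c₁ * (G₀ * t₂) := by ring
      _ = e * c₁ * F₀ * t₁ := by rw [← hstar]; ring
      _ = c₂ * t₁ * G₀ := by rw [hdag]; ring

end Collinear

/-! ## §3 KATO-RIGID ⟸ thm12_4 + AUG -/

section Assembly

set_option backward.isDefEq.respectTransparency false in
set_option maxHeartbeats 1600000 in
/-- **KATO-RIGID ⟸ Kato Thm. 12.4 (2) + AUG.**  `h12 = Kato2004.thm12_4` (𝐇¹ torsion free of Λ-rank 1, named fact);
`hAUG` = the display AUG: the binders of KATO-RIGID (E25 `prInv_of_lev_of_unit_of_katoRigid`'s `hKR`, verbatim up to the pin and the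
two lifts) followed by «for every PRIMITIVE COLLINEAR pair `F • y₁ = G • y₂` (`F(0) ≠ 0 ∨ G(0) ≠ 0`) in `I.H`:
`e·(q₁R₁E₁)·F(0) = (q₂R₂E₂)·G(0)`» [Kato §13.9, p. 230: the images of the two elements under (13.7.1), computed by Thm 6.6 and
Thm 9.7, at the trivial character]; conclusion = KATO-RIGID VERBATIM.  Proof: `exists_primitive_collinear` (from `h12`),
`constantCoeff_mul_kummerLog_eq` (bottom layer + Kummer logarithm), `hAUG`, `mul_eq_mul_of_collinear`.  `h12` is a named fact and AUG a
display — nothing about Kato's classes is asserted; no stub is closed; BSD is not proved for any curve.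
[cite: Kato2004Asterisque, Thm. 12.4 (2) (p. 221) and §13.9–Lemma 13.10 (pp. 229–230)] [cite: BlochKato1990, Example 3.11] -/
theorem katoRigid_of_thm12_4_of_aug (h12 : Kato2004.thm12_4)
    (hAUG : ∀ (W : WeierstrassCurve ℚ) [W.IsElliptic] [W.IsGloballyMinimal] (p : ℕ) [Fact p.Prime],
      letI : ContinuousSMul ℤ_[p] (W.tateModule p) := TateModule.continuousSMul_padicInt
      letI : Module.Free ℤ_[p] (W.tateModule p) := W.module_free_tateModule_holds p
      letI : Module.Finite ℤ_[p] (W.tateModule p) := W.module_finite_tateModule_holds p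
      ∀ (hp : p ≠ 2) {N : ℕ} [NeZero N] (f : CuspForm (Gamma0 N) 2), IsNewformOf W f →
      ∀ (ι₁ ι₂ : (n : ℕ) → (CyclotomicField n ℚ →+* ℂ)) (q₁ q₂ : ℚ)
        (Λ₁ Λ₂ : ∀ (k : ℕ) (r : Finset (HeightOneSpectrum (𝓞 ℚ))),
          H1 (tateRep W p) (cycSubgroup p k r) →ₗ[ℤ_[p]] ℚ_[p] ⊗[ℚ] CyclotomicField (cycLevel p k r) ℚ) (e : ℚ_[p]),
        q₁ ≠ 0 → q₂ ≠ 0 → e ≠ 0 → (∀ (k : ℕ) (y : H1 (tateRep W p) (cycSubgroup p k ∅)), Λ₂ k ∅ y = e • Λ₁ k ∅ y) →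
      ∀ (c₁ d₁ a₁ : ℤ) (A₁ : ℕ) (d'₁ : ℤ) (c₂ d₂ a₂ : ℤ) (A₂ : ℕ) (d'₂ : ℤ),
        0 < A₁ → Int.gcd c₁ (6 * p * A₁) = 1 → Int.gcd d₁ (6 * p * N) = 1 → (d₁ : ℤ) * d'₁ ≡ 1 [ZMOD (A₁ : ℤ)] →
        ratCuspFactor f true c₁ d₁ a₁ A₁ d'₁ ≠ 0 →
        0 < A₂ → Int.gcd c₂ (6 * p * A₂) = 1 → Int.gcd d₂ (6 * p * N) = 1 → (d₂ : ℤ) * d'₂ ≡ 1 [ZMOD (A₂ : ℤ)] →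
        ratCuspFactor f true c₂ d₂ a₂ A₂ d'₂ ≠ 0 →
      ∀ (z₁ : ∀ (k : ℕ) (r : (cyclotomicLevelsRat p (badPlaces c₁ d₁ A₁ N)).Ideals),
          H1 (tateRep W p) ((cyclotomicLevelsRat p (badPlaces c₁ d₁ A₁ N)).level k r.1))
        (x₁ : ∀ (k : ℕ) (r : (cyclotomicLevelsRat p (badPlaces c₁ d₁ A₁ N)).Ideals), CyclotomicField (cycLevel p k r.1) ℚ),
        ZetaBody W p f ι₁ ((q₁ : ℚ) : ℝ) Λ₁ c₁ d₁ a₁ A₁ z₁ x₁ →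
      ∀ (z₂ : ∀ (k : ℕ) (r : (cyclotomicLevelsRat p (badPlaces c₂ d₂ A₂ N)).Ideals),
          H1 (tateRep W p) ((cyclotomicLevelsRat p (badPlaces c₂ d₂ A₂ N)).level k r.1))
        (x₂ : ∀ (k : ℕ) (r : (cyclotomicLevelsRat p (badPlaces c₂ d₂ A₂ N)).Ideals), CyclotomicField (cycLevel p k r.1) ℚ),
        ZetaBody W p f ι₂ ((q₂ : ℚ) : ℝ) Λ₂ c₂ d₂ a₂ A₂ z₂ x₂ →
      ∀ (K : ZpExtension ℚ p) (hK : K.IsCyclotomic) (γ : absoluteGaloisGroup ℚ), K.IsTopGenerator γ →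
      ∀ (I : IwasawaH1Data W p K γ) (y₁ y₂ : I.H),
        (∀ n : ℕ, I.proj n y₁ = levelToLayer W p hK hp (badPlaces c₁ d₁ A₁ N) n
          (z₁ (n + 1) (cyclotomicLevelsRat p (badPlaces c₁ d₁ A₁ N)).idealOne)) →
        (∀ n : ℕ, I.proj n y₂ = levelToLayer W p hK hp (badPlaces c₂ d₂ A₂ N) n
          (z₂ (n + 1) (cyclotomicLevelsRat p (badPlaces c₂ d₂ A₂ N)).idealOne)) →
      ∀ (F G : IwasawaAlgebra p), F • y₁ = G • y₂ →
        (PowerSeries.constantCoeff F ≠ 0 ∨ PowerSeries.constantCoeff G ≠ 0) →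
        e * ((q₁ * ratCuspFactor f true c₁ d₁ a₁ A₁ d'₁ * ∏ ℓ ∈ (p * A₁).primeFactors, eulerFactorAtOne W N ℓ : ℚ) : ℚ_[p]) * ((PowerSeries.constantCoeff F : ℤ_[p]) : ℚ_[p]) =
          ((q₂ * ratCuspFactor f true c₂ d₂ a₂ A₂ d'₂ * ∏ ℓ ∈ (p * A₂).primeFactors, eulerFactorAtOne W N ℓ : ℚ) : ℚ_[p]) * ((PowerSeries.constantCoeff G : ℤ_[p]) : ℚ_[p])) :
    ∀ (W : WeierstrassCurve ℚ) [W.IsElliptic] [W.IsGloballyMinimal] (p : ℕ) [Fact p.Prime],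
      letI : ContinuousSMul ℤ_[p] (W.tateModule p) := TateModule.continuousSMul_padicInt
      letI : Module.Free ℤ_[p] (W.tateModule p) := W.module_free_tateModule_holds p
      letI : Module.Finite ℤ_[p] (W.tateModule p) := W.module_finite_tateModule_holds p
      ∀ (hp : p ≠ 2) {N : ℕ} [NeZero N] (f : CuspForm (Gamma0 N) 2), IsNewformOf W f →
      ∀ (ι₁ ι₂ : (n : ℕ) → (CyclotomicField n ℚ →+* ℂ)) (q₁ q₂ : ℚ)
        (Λ₁ Λ₂ : ∀ (k : ℕ) (r : Finset (HeightOneSpectrum (𝓞 ℚ))),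
          H1 (tateRep W p) (cycSubgroup p k r) →ₗ[ℤ_[p]] ℚ_[p] ⊗[ℚ] CyclotomicField (cycLevel p k r) ℚ) (e : ℚ_[p]),
        q₁ ≠ 0 → q₂ ≠ 0 → e ≠ 0 → (∀ (k : ℕ) (y : H1 (tateRep W p) (cycSubgroup p k ∅)), Λ₂ k ∅ y = e • Λ₁ k ∅ y) →
      ∀ (c₁ d₁ a₁ : ℤ) (A₁ : ℕ) (d'₁ : ℤ) (c₂ d₂ a₂ : ℤ) (A₂ : ℕ) (d'₂ : ℤ),
        0 < A₁ → Int.gcd c₁ (6 * p * A₁) = 1 → Int.gcd d₁ (6 * p * N) = 1 → (d₁ : ℤ) * d'₁ ≡ 1 [ZMOD (A₁ : ℤ)] →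
        ratCuspFactor f true c₁ d₁ a₁ A₁ d'₁ ≠ 0 →
        0 < A₂ → Int.gcd c₂ (6 * p * A₂) = 1 → Int.gcd d₂ (6 * p * N) = 1 → (d₂ : ℤ) * d'₂ ≡ 1 [ZMOD (A₂ : ℤ)] →
        ratCuspFactor f true c₂ d₂ a₂ A₂ d'₂ ≠ 0 →
      ∀ (z₁ : ∀ (k : ℕ) (r : (cyclotomicLevelsRat p (badPlaces c₁ d₁ A₁ N)).Ideals),
          H1 (tateRep W p) ((cyclotomicLevelsRat p (badPlaces c₁ d₁ A₁ N)).level k r.1))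
        (x₁ : ∀ (k : ℕ) (r : (cyclotomicLevelsRat p (badPlaces c₁ d₁ A₁ N)).Ideals), CyclotomicField (cycLevel p k r.1) ℚ),
        ZetaBody W p f ι₁ ((q₁ : ℚ) : ℝ) Λ₁ c₁ d₁ a₁ A₁ z₁ x₁ →
      ∀ (z₂ : ∀ (k : ℕ) (r : (cyclotomicLevelsRat p (badPlaces c₂ d₂ A₂ N)).Ideals),
          H1 (tateRep W p) ((cyclotomicLevelsRat p (badPlaces c₂ d₂ A₂ N)).level k r.1))
        (x₂ : ∀ (k : ℕ) (r : (cyclotomicLevelsRat p (badPlaces c₂ d₂ A₂ N)).Ideals), CyclotomicField (cycLevel p k r.1) ℚ),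
        ZetaBody W p f ι₂ ((q₂ : ℚ) : ℝ) Λ₂ c₂ d₂ a₂ A₂ z₂ x₂ →
      ∀ (K : ZpExtension ℚ p) (hK : K.IsCyclotomic) (γ : absoluteGaloisGroup ℚ), K.IsTopGenerator γ →
      ∀ (I : IwasawaH1Data W p K γ) (y₁ y₂ : I.H),
        (∀ n : ℕ, I.proj n y₁ = levelToLayer W p hK hp (badPlaces c₁ d₁ A₁ N) n
          (z₁ (n + 1) (cyclotomicLevelsRat p (badPlaces c₁ d₁ A₁ N)).idealOne)) →
        (∀ n : ℕ, I.proj n y₂ = levelToLayer W p hK hp (badPlaces c₂ d₂ A₂ N) n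
          (z₂ (n + 1) (cyclotomicLevelsRat p (badPlaces c₂ d₂ A₂ N)).idealOne)) →
      ∀ (t₁ t₂ : ℚ_[p]), HasLocPKummerLog W p (layerZeroToTop W p K (I.proj 0 y₁)) t₁ →
        HasLocPKummerLog W p (layerZeroToTop W p K (I.proj 0 y₂)) t₂ →
        e * ((q₁ * ratCuspFactor f true c₁ d₁ a₁ A₁ d'₁ * ∏ ℓ ∈ (p * A₁).primeFactors, eulerFactorAtOne W N ℓ : ℚ) : ℚ_[p]) * t₂ =
          ((q₂ * ratCuspFactor f true c₂ d₂ a₂ A₂ d'₂ * ∏ ℓ ∈ (p * A₂).primeFactors, eulerFactorAtOne W N ℓ : ℚ) : ℚ_[p]) * t₁ := by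
  intro W _ _ p _
  letI instC : ContinuousSMul ℤ_[p] (W.tateModule p) := TateModule.continuousSMul_padicInt
  letI instF : Module.Free ℤ_[p] (W.tateModule p) := W.module_free_tateModule_holds p
  letI instFi : Module.Finite ℤ_[p] (W.tateModule p) := W.module_finite_tateModule_holds p
  intro hp N _ f hf ι₁ ι₂ q₁ q₂ Λ₁ Λ₂ e hq₁ hq₂ he hΛ c₁ d₁ a₁ A₁ d'₁ c₂ d₂ a₂ A₂ d'₂ hA₁ hc₁ hd₁ hdd₁ hR₁ hA₂ hc₂ hd₂ hdd₂
    hR₂ z₁ x₁ hζ₁ z₂ x₂ hζ₂ K hK γ hγ I y₁ y₂ hy₁ hy₂ t₁ t₂ ht₁ ht₂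
  -- Thm. 12.4 (2): `I.H` is torsion free of rank one
  obtain ⟨-, ⟨hTF, hrank⟩, -⟩ := h12 W p K γ hK hγ I
  haveI := hTF
  -- a primitive collinearity relation and its bottom layer
  obtain ⟨F, G, hFG, hprim⟩ := exists_primitive_collinear hrank y₁ y₂
  have hstar := constantCoeff_mul_kummerLog_eq W p I hFG ht₁ ht₂
  -- AUG
  have hdag := hAUG W p hp f hf ι₁ ι₂ q₁ q₂ Λ₁ Λ₂ e hq₁ hq₂ he hΛ c₁ d₁ a₁ A₁ d'₁ c₂ d₂ a₂ A₂ d'₂ hA₁ hc₁ hd₁ hdd₁ hR₁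
    hA₂ hc₂ hd₂ hdd₂ hR₂ z₁ x₁ hζ₁ z₂ x₂ hζ₂ K hK γ hγ I y₁ y₂ hy₁ hy₂ F G hFG hprim
  have hprim' : ((PowerSeries.constantCoeff F : ℤ_[p]) : ℚ_[p]) ≠ 0 ∨
      ((PowerSeries.constantCoeff G : ℤ_[p]) : ℚ_[p]) ≠ 0 :=
    hprim.imp (fun h => mt PadicInt.coe_eq_zero.mp h) (fun h => mt PadicInt.coe_eq_zero.mp h)
  exact mul_eq_mul_of_collinear hprim' hstar hdag

end Assembly

end Summit.BirchSwinnertonDyer.Rank1Residual.Additive.PerrinRiouUnit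

end
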